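import Literature.NumberTheory.LFunctions.Zhang2022.RepairBandMeanValue

/-!
# Zhang (2022) §18-margin repair rung — barrier extension `R⁺⁺`: the smooth wall-zero rows FROM THE WALL TO ANY LENGTH in
# their clean form «`|Δ discMean| ≤ η·(discMeanAbs⌈P⌉ + 𝔞𝔓)` for every `η > 0`», conditional on the large-sieve-type slot
# E-004′(κ), `κ < 6`, and the manuscript's four mean-value nodes only

Trunk T-ANT (NumberTheory/LFunctions). Y. Zhang, *Discrete mean estimates and the Landau–Siegel
zero*, arXiv:2211.02515v1 (2022) [Zhang2022LandauSiegel] — **an unrefereed manuscript under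
adjudication. WHAT THIS IS NOT: nothing here asserts or denies its Theorems 1–2 or any analytic lemma;
no claim about Landau–Siegel zeros, about Parity, or about a repaired `Margin232` is made; `Repair.BandMeanValue` is an
E*-SLOT (kind (c), NOT asserted); `Prop71`, `Lemma81`, `Prop22i`, `Lemma23` are CLAIMS OF THE MANUSCRIPT, displayed as
binders, never asserted.** Cell `landau-siegel` (rung F-S3), sub-cell E, seat ls-barrier-p2 g3.

## What is proved (kernel)

With the reduction of `RepairBandMeanValue.lean` (E-004 ⇐ E-004′(κ), `κ < 6`) the verdicts of the true-band rows 35–38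
(p470415, p471890) lose their `𝓛^{−A}` band-edge terms: both `𝓛^{−A}·discMeanAbs(bandEdge)`
(`Repair.discMeanAbs_le_two_mul_add_coefBlockMean` + the band block mean, `coefBlockMean_profCoef_le_of_bandMeanValue`)
and `𝓛^{−A}·max(K,M)²·discWeight` (units lemma p467613 + `𝔞 ≥ a₀`) are `o(discMeanAbs⌈P⌉ + 𝔞𝔓)` at `A = 10`. Hence:

* `discMean_fromWall_of_bandMeanValue` — for every `δ > 0`, `κ < 6`, `η > 0`, `K`, `M`:
  `BandMeanValue c′ 1078 κ → Prop71 c′ → Lemma81 c′ → Prop22i → Lemma23 c′ →` for all large `D`, under (A) and (b), for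
  every `g ∈ GluedWallZeroClass K M` (K-Lipschitz, `‖·‖ ≤ M` on `[1,∞)`, `g(1) = 0`; nothing asked below the wall) and
  EVERY `⌈P⌉ ≤ N ≤ ⌈P^{1+δ}⌉`: `|discMean(N) − discMean(⌈P⌉)| ≤ η·(discMeanAbs(⌈P⌉) + 𝔞𝔓)`;
  `discMean_fromWall_topVanishing_of_bandMeanValue` — every `N ≥ ⌈P⌉` for a top-vanishing profile.
* rows `Repair.familyWallZeroBandMV` / `familyWallZeroTopBandMV` (design types of p459259) and
  `familySmoothWallZeroBandMV` / `familySmoothTopWallZeroBandMV` (design types of p457377 with `g(1) = 0`, = the classes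
  of rows 37–38 literally: `_inClass_iff`), each `_decided`, `rplus_bandMV_decided`; C2/C4 by name
  (`inClassWall0_ofWallZero(Top)`, `inClassWall0_glue`, `inClass_triangle`).

READING: closing past the wall by a main-order amount with a smooth wall-zero overhang of ANY length (disc-mean currency)
needs the FAILURE of E-004′(κ) for EVERY `κ < 6` — a weighted large-sieve constant of the sampled family at band lengths
`N ≤ D·P·𝓛^{1078}` exceeding `𝓛^{6−o(1)} ×` trivial — given the manuscript's own nodes and (A). The band exponent `1078`
(`= 1058 + 2·10`) is fixed once and for all (`BandMeanValue.mono`: any `m ≥ 1078` serves).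

CURRENCY (REF-E C3(e)): discrete mean; (b) `Re ρ = ½`, (c) `BandMeanValue c′ 1078 κ`, the four nodes and (A) displayed.

**v2/v3 (same seat, same day) — ROWS OF RECORD 41′–44′.** The class-restricted slot E-004″ `BandMeanValueLip` is the
logically WEAKER premise (`BandMeanValue ⇒ BandMeanValueLip`), so the primed rows below are the stronger theorems and the
recommended rows of record; rows 41–44 above stay valid rows (v3 ERRATUM: the v2 sentence calling their all-coefficients
premise «model-false» is WITHDRAWN — the corrected model bookkeeping, a variance over residue classes after the
principal-character projection, gives loss `O(1)` for every sequence not phase-aligned inside the classes of a single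
modulus; see the MODEL NOTE on `Repair.BandMeanValue`). Part 5 re-proves the engines from the
CLASS-RESTRICTED slot `BandMeanValueOn 𝒞` for any class `𝒞 ⊇ profCoefClass K` and Part 6 files the rows of record
`familyWallZeroBandMVLip` / `familyWallZeroTopBandMVLip` / `familySmoothWallZeroBandMVLip` / `familySmoothTopWallZeroBandMVLip`
displaying E-004″ `BandMeanValueLip d.c′ K 1078 κ` (`K = 1` for the design types of p459259, `K = d.K` for those of p457377):
the band mean-square inequality for the class's OWN coefficient sequences only (= E-004 in mean-square form, room `𝓛⁶`).

## References

* Y. Zhang, arXiv:2211.02515v1 (2022), §2 (2.14)–(2.20), (2.30)–(2.33), Lemma 2.3, Prop. 2.2; §5 Lemma 5.7; §7 Prop 7.1,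
  (7.2) [p. 44]; §8 Lemma 8.1. [cite: Zhang2022LandauSiegel, §§2, 5, 7, 8]
* H. Iwaniec, E. Kowalski, *Analytic Number Theory*, AMS Colloquium Publ. 53 (2004), Thm 7.13 (the multiplicative large
  sieve; v4 cite erratum, courtesy zl-lit-2 g4). [cite: IwaniecKowalski2004, Thm 7.13]
-/

noncomputable section

open Real Complex Finset
open scoped NNReal

namespace Literature.NumberTheory.LFunctions.Zhang2022

namespace Repair

open Skeleton

/-! ### Part 1 — the band block mean and the weight term at the main scale -/

/-- **The band block of a wall-zero Lipschitz profile is `o(𝔞𝔓)` given E-004′(κ), `κ < 6`** (modulo the four nodes,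
under (A) and (b)): for every `ε > 0`, eventually, for every `g ∈ WallZeroLip K` and every `⌈P⌉ ≤ N ≤ bandEdge D m`,
`coefBlockMean(⌈P⌉, N) ≤ ε·𝔞𝔓` (`𝓛^κ · 3𝓛⁹𝔓 · K²(m+3)³𝓛^{−15} ≤ ε·a₀·𝔓`).
[cite: Zhang2022LandauSiegel, §2 (2.16), (2.30)–(2.31); §7 Prop 7.1; §8 Lemma 8.1] -/
theorem coefBlockMean_profCoef_le_of_bandMeanValue (c' : ℝ) (m : ℕ) (K : ℝ≥0) {κ ε : ℝ} (hκ : κ < 6)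
    (hε : 0 < ε) (hB : BandMeanValue c' m κ) (h71 : Prop71 c') (h81 : Lemma81 c') (h22 : Prop22i)
    (h23 : Lemma23 c') :
    Skeleton.ForAllLarge fun D _ χ => Skeleton.AssumptionA D χ →
      (∀ i ∈ Skeleton.idx χ, (i.2).re = 1 / 2) →
        ∀ g : ℝ → ℂ, WallZeroLip K g → ∀ N : ℕ, ⌈Skeleton.bigP D⌉₊ ≤ N → N ≤ bandEdge D m →
          coefBlockMean c' χ (profCoef D g) ⌈Skeleton.bigP D⌉₊ N ≤ ε * (Skeleton.frakA χ * frakP D) := by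
  obtain ⟨a₀, ha₀, hA⟩ := frakALowerBound_holds
  have hW := Skeleton.discWeight_trivialScale_window c' h71 h81 h22 h23
  set C : ℝ := 3 * ((K : ℝ) ^ 2 * ((m : ℝ) + 3) ^ 3) with hCdef
  have hroom := loss_le_room_eventually hκ C (ε := ε * a₀) (by positivity)
  refine ((((hB.and hW).and hA).and ((coefBlockMass_profCoef_le m).and hroom)).and
    (forAllLarge_three_le_and_le_ell 1)).mono ?_
  intro D _ χ _ _ h hAss hb g hg N hN₁ hN₂
  obtain ⟨⟨⟨⟨hBD, hWD⟩, hAD⟩, hMD, hRD⟩, hD3, -⟩ := h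
  have hℓ0 : 0 < Skeleton.ell D := zero_lt_one.trans (Skeleton.one_lt_ell hD3)
  have hfP : 0 ≤ frakP D := frakP_nonneg D
  have hκ0 : 0 ≤ Skeleton.ell D ^ κ := Real.rpow_nonneg hℓ0.le κ
  have h1 := hBD hb (profCoef D g) N hN₁ hN₂
  have h2 := hMD K g hg N hN₁ hN₂
  have h3 : discWeight c' χ ≤ 3 * Skeleton.ell D ^ 9 * frakP D := (hWD hAss).2
  have h4 : a₀ ≤ Skeleton.frakA χ := hAD hAss
  have hstep : coefBlockMean c' χ (profCoef D g) ⌈Skeleton.bigP D⌉₊ N ≤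
      Skeleton.ell D ^ κ * (3 * Skeleton.ell D ^ 9 * frakP D) *
        ((K : ℝ) ^ 2 * ((m : ℝ) + 3) ^ 3 * (Skeleton.ell D ^ 15)⁻¹) := by
    refine h1.trans (mul_le_mul ?_ h2 (coefBlockMass_nonneg _ _ _) (mul_nonneg hκ0 (by positivity)))
    exact mul_le_mul_of_nonneg_left h3 hκ0
  have hid : Skeleton.ell D ^ κ * (3 * Skeleton.ell D ^ 9 * frakP D) *
      ((K : ℝ) ^ 2 * ((m : ℝ) + 3) ^ 3 * (Skeleton.ell D ^ 15)⁻¹) =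
      (C * Skeleton.ell D ^ κ) * (frakP D * (Skeleton.ell D ^ 9 * (Skeleton.ell D ^ 15)⁻¹)) := by
    rw [hCdef]; ring
  have hid2 : ε * a₀ * Skeleton.ell D ^ 6 * (frakP D * (Skeleton.ell D ^ 9 * (Skeleton.ell D ^ 15)⁻¹)) =
      ε * (a₀ * frakP D) := by
    field_simp
  calc coefBlockMean c' χ (profCoef D g) ⌈Skeleton.bigP D⌉₊ N
      ≤ (C * Skeleton.ell D ^ κ) * (frakP D * (Skeleton.ell D ^ 9 * (Skeleton.ell D ^ 15)⁻¹)) := hstep.trans hid.le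
    _ ≤ (ε * a₀ * Skeleton.ell D ^ 6) * (frakP D * (Skeleton.ell D ^ 9 * (Skeleton.ell D ^ 15)⁻¹)) :=
        mul_le_mul_of_nonneg_right hRD (by positivity)
    _ = ε * (a₀ * frakP D) := hid2
    _ ≤ ε * (Skeleton.frakA χ * frakP D) :=
        mul_le_mul_of_nonneg_left (mul_le_mul_of_nonneg_right h4 hfP) hε.le

/-- **The weight term at the main scale** (units lemma p467613 + `𝔞 ≥ a₀`): for every `B` and `ε > 0`, eventually under
(A), `𝓛^{−10}·B·discWeight ≤ ε·𝔞𝔓` (`≤ 3B·𝓛^{−1}·𝔓`). [cite: Zhang2022LandauSiegel, §2 (2.16), (2.31); §5 Lemma 5.7; §7 Prop 7.1; §8 Lemma 8.1] -/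
theorem inv_ell_pow_ten_mul_discWeight_le (c' : ℝ) (B : ℝ) {ε : ℝ} (hε : 0 < ε) (h71 : Prop71 c')
    (h81 : Lemma81 c') (h22 : Prop22i) (h23 : Lemma23 c') :
    Skeleton.ForAllLarge fun D _ χ => Skeleton.AssumptionA D χ →
      (Skeleton.ell D ^ 10)⁻¹ * (B * discWeight c' χ) ≤ ε * (Skeleton.frakA χ * frakP D) := by
  obtain ⟨a₀, ha₀, hA⟩ := frakALowerBound_holds
  have hW := Skeleton.discWeight_trivialScale_window c' h71 h81 h22 h23
  refine ((hW.and hA).and (forAllLarge_three_le_and_le_ell (3 * |B| / (ε * a₀)))).mono ?_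
  intro D _ χ _ _ h hAss
  obtain ⟨⟨hWD, hAD⟩, hD3, hL⟩ := h
  have hℓ1 : 1 < Skeleton.ell D := Skeleton.one_lt_ell hD3
  have hℓ0 : 0 < Skeleton.ell D := zero_lt_one.trans hℓ1
  have hfP : 0 ≤ frakP D := frakP_nonneg D
  have h3 : discWeight c' χ ≤ 3 * Skeleton.ell D ^ 9 * frakP D := (hWD hAss).2
  have h4 : a₀ ≤ Skeleton.frakA χ := hAD hAss
  have hw0 : 0 ≤ discWeight c' χ := Finset.sum_nonneg fun _ _ => abs_nonneg _
  -- `𝓛^{−10}·|B|·3𝓛⁹𝔓 = 3|B|·𝔓/𝓛 ≤ ε a₀ 𝔓`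
  have hBabs : B * discWeight c' χ ≤ |B| * (3 * Skeleton.ell D ^ 9 * frakP D) :=
    (mul_le_mul_of_nonneg_right (le_abs_self B) hw0).trans (mul_le_mul_of_nonneg_left h3 (abs_nonneg B))
  have hkey : (Skeleton.ell D ^ 10)⁻¹ * (|B| * (3 * Skeleton.ell D ^ 9 * frakP D)) =
      (3 * |B| / Skeleton.ell D) * frakP D := by
    field_simp
  have hL' : 3 * |B| / Skeleton.ell D ≤ ε * a₀ := by
    rw [div_le_iff₀ hℓ0]
    have := (div_le_iff₀ (by positivity : 0 < ε * a₀)).mp hL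
    linarith
  calc (Skeleton.ell D ^ 10)⁻¹ * (B * discWeight c' χ)
      ≤ (Skeleton.ell D ^ 10)⁻¹ * (|B| * (3 * Skeleton.ell D ^ 9 * frakP D)) :=
        mul_le_mul_of_nonneg_left hBabs (by positivity)
    _ = (3 * |B| / Skeleton.ell D) * frakP D := hkey
    _ ≤ ε * a₀ * frakP D := mul_le_mul_of_nonneg_right hL' hfP
    _ ≤ ε * (Skeleton.frakA χ * frakP D) := by
        rw [mul_assoc]; exact mul_le_mul_of_nonneg_left (mul_le_mul_of_nonneg_right h4 hfP) hε.le

/-! ### Part 2 — the (A)-form chain of p471890 and the CLEAN from-the-wall theorem -/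

/-- The glued class restricts to «`K`-Lipschitz and bounded by `M` on `[1, ∞)`». [folklore] -/
private theorem gluedClass_restrict' (K : ℝ≥0) (M : ℝ) (g : ℝ → ℂ) (hg : GluedWallZeroClass K M g) :
    LipschitzOnWith K g (Set.Ici 1) ∧ ∀ z : ℝ, 1 ≤ z → ‖g z‖ ≤ M := ⟨hg.1, hg.2.1⟩

/-- **The chain of p471890 with (A) displayed**: from the wall to any length `≤ ⌈P^{1+δ}⌉` for a class
`V ⊆` «`K`-Lipschitz, `‖·‖ ≤ M` on `[1, ∞)`», conditionally on the (A)-form slot `DiscMeanTrueBandAOn V c′ (1058+2A) η`;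
beyond the band edge the band-scale flatness p470027 takes over. [cite: Zhang2022LandauSiegel, §2 (2.16)–(2.20), (2.30); §8 Lemma 8.1] -/
theorem discMean_fromWall_of_trueBandAOn_KM {V : (ℝ → ℂ) → Prop} (c' : ℝ) {δ : ℝ} (hδ : 0 < δ) (A : ℕ)
    {K : ℝ≥0} {M η : ℝ}
    (hV : ∀ g, V g → LipschitzOnWith K g (Set.Ici 1) ∧ ∀ z : ℝ, 1 ≤ z → ‖g z‖ ≤ M)
    (hB : DiscMeanTrueBandAOn V c' (1058 + 2 * A) η) :
    Skeleton.ForAllLarge fun D _ χ => Skeleton.AssumptionA D χ →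
      (∀ i ∈ Skeleton.idx χ, (i.2).re = 1 / 2) →
        ∀ g : ℝ → ℂ, V g → ∀ N : ℕ, ⌈Skeleton.bigP D⌉₊ ≤ N → N ≤ ⌈Skeleton.bigP D ^ (1 + δ)⌉₊ →
          |discMean c' χ g N - discMean c' χ g ⌈Skeleton.bigP D⌉₊| ≤
            η * (discMeanAbs c' χ g ⌈Skeleton.bigP D⌉₊ + Skeleton.frakA χ * frakP D) +
              (Skeleton.ell D ^ A)⁻¹ *
                (discMeanAbs c' χ g (bandEdge D (1058 + 2 * A)) + max (K : ℝ) M ^ 2 * discWeight c' χ) := by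
  refine ((Skeleton.ForAllLarge.and hB
    (KnifeEdgeInvisibleTail.discMeanFlat_bandEdge_lipschitzOn c' hδ A)).and
      (Skeleton.ForAllLarge.of_le 3 fun D _ _ hD _ _ => hD)).mono ?_
  intro D _ χ _ _ h hAss hA g hg N hN₁ hN₂
  obtain ⟨⟨hband, hflat⟩, hD3⟩ := h
  have hℓ : 0 ≤ (Skeleton.ell D ^ A)⁻¹ :=
    inv_nonneg.mpr (pow_nonneg (zero_le_one.trans (Skeleton.one_lt_ell hD3).le) A)
  have hT0 : 0 ≤ (Skeleton.ell D ^ A)⁻¹ *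
      (discMeanAbs c' χ g (bandEdge D (1058 + 2 * A)) + max (K : ℝ) M ^ 2 * discWeight c' χ) :=
    mul_nonneg hℓ (add_nonneg (Finset.sum_nonneg fun _ _ => mul_nonneg (abs_nonneg _) (sq_nonneg _))
      (mul_nonneg (sq_nonneg _) (Finset.sum_nonneg fun _ _ => abs_nonneg _)))
  by_cases hNb : N ≤ bandEdge D (1058 + 2 * A)
  · exact (hband hAss hA g hg N hN₁ hNb).trans (le_add_of_nonneg_right hT0)
  · have hNb' : bandEdge D (1058 + 2 * A) ≤ N := (not_le.mp hNb).le
    have hE₁ : ⌈Skeleton.bigP D⌉₊ ≤ bandEdge D (1058 + 2 * A) := ceil_bigP_le_bandEdge hD3 _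
    have h1 := hband hAss hA g hg (bandEdge D (1058 + 2 * A)) hE₁ le_rfl
    have h2 := hflat hA g K M (hV g hg).1 (hV g hg).2 (bandEdge D (1058 + 2 * A)) N le_rfl hNb' hN₂
    calc |discMean c' χ g N - discMean c' χ g ⌈Skeleton.bigP D⌉₊|
        = |(discMean c' χ g (bandEdge D (1058 + 2 * A)) - discMean c' χ g ⌈Skeleton.bigP D⌉₊) +
            (discMean c' χ g N - discMean c' χ g (bandEdge D (1058 + 2 * A)))| := by ring_nf
      _ ≤ |discMean c' χ g (bandEdge D (1058 + 2 * A)) - discMean c' χ g ⌈Skeleton.bigP D⌉₊| +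
            |discMean c' χ g N - discMean c' χ g (bandEdge D (1058 + 2 * A))| := abs_add_le _ _
      _ ≤ _ := add_le_add h1 h2

/-- **THE CLEAN FROM-THE-WALL THEOREM (bounded lengths).** For every `δ > 0`, `κ < 6`, `η > 0`, `K`, `M`: GIVEN the
large-sieve-type slot `BandMeanValue c′ 1078 κ` and the manuscript's nodes Prop 7.1, Lemma 8.1, Prop 2.2 (i), Lemma 2.3,
for all large `D`, under (A) and (b), for every profile `g` that is `K`-Lipschitz with `‖g‖ ≤ M` on `[1, ∞)` and `g(1) = 0`
(nothing asked below the wall) and EVERY length `⌈P⌉ ≤ N ≤ ⌈P^{1+δ}⌉`: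
`|discMean(N) − discMean(⌈P⌉)| ≤ η·(discMeanAbs(⌈P⌉) + 𝔞𝔓)` — no band-edge term, no `𝓛^{−A}` term.
[cite: Zhang2022LandauSiegel, §2 (2.16)–(2.20), (2.30)–(2.31), Lemma 2.3; §5 Lemma 5.7; §7 Prop 7.1; §8 Lemma 8.1] -/
theorem discMean_fromWall_of_bandMeanValue (c' : ℝ) {δ : ℝ} (hδ : 0 < δ) (K : ℝ≥0) (M : ℝ) {κ η : ℝ}
    (hκ : κ < 6) (hη : 0 < η) (hB : BandMeanValue c' 1078 κ) (h71 : Prop71 c') (h81 : Lemma81 c')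
    (h22 : Prop22i) (h23 : Lemma23 c') :
    Skeleton.ForAllLarge fun D _ χ => Skeleton.AssumptionA D χ →
      (∀ i ∈ Skeleton.idx χ, (i.2).re = 1 / 2) →
        ∀ g : ℝ → ℂ, GluedWallZeroClass K M g → ∀ N : ℕ, ⌈Skeleton.bigP D⌉₊ ≤ N →
          N ≤ ⌈Skeleton.bigP D ^ (1 + δ)⌉₊ →
            |discMean c' χ g N - discMean c' χ g ⌈Skeleton.bigP D⌉₊| ≤
              η * (discMeanAbs c' χ g ⌈Skeleton.bigP D⌉₊ + Skeleton.frakA χ * frakP D) := by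
  have hη4 : 0 < η / 4 := by positivity
  -- the (A)-form slot at `η/4`, `m = 1078 = 1058 + 2·10`, from the reduction
  have hslot : DiscMeanTrueBandAOn (GluedWallZeroClass K M) c' (1058 + 2 * 10) (η / 4) :=
    discMeanTrueBandAKM_of_bandMeanValue c' K M 1078 hκ hη4 hB h71 h81 h22 h23
  have hchain := discMean_fromWall_of_trueBandAOn_KM c' hδ 10 (gluedClass_restrict' K M) hslot
  -- the band block at the edge and the weight term, each `≤ (η/4)·𝔞𝔓`-ish
  have hblock := coefBlockMean_profCoef_le_of_bandMeanValue c' 1078 K hκ hη4 hB h71 h81 h22 h23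
  have hweight := inv_ell_pow_ten_mul_discWeight_le c' (max (K : ℝ) M ^ 2) hη4 h71 h81 h22 h23
  refine (((hchain.and hblock).and hweight).and (forAllLarge_three_le_and_le_ell (8 / η))).mono ?_
  intro D _ χ _ _ h hAss hb g hg N hN₁ hN₂
  obtain ⟨⟨⟨hC, hBl⟩, hWt⟩, hD3, hL⟩ := h
  have hA0 : 0 ≤ Skeleton.frakA χ := Skeleton.frakA_nonneg χ
  have hℓ1 : 1 < Skeleton.ell D := Skeleton.one_lt_ell hD3
  have hℓ0 : 0 < Skeleton.ell D := zero_lt_one.trans hℓ1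
  have hfP : 0 ≤ frakP D := frakP_nonneg D
  have hP0 : 0 < Skeleton.bigP D := Real.exp_pos _
  have hM₀1 : 1 ≤ ⌈Skeleton.bigP D⌉₊ := Nat.one_le_ceil_iff.mpr hP0
  have hE₁ : ⌈Skeleton.bigP D⌉₊ ≤ bandEdge D 1078 := ceil_bigP_le_bandEdge hD3 _
  set X : ℝ := discMeanAbs c' χ g ⌈Skeleton.bigP D⌉₊ + Skeleton.frakA χ * frakP D with hX
  have hAbs0 : 0 ≤ discMeanAbs c' χ g ⌈Skeleton.bigP D⌉₊ := discMeanAbs_nonneg c' χ g _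
  have hfA0 : 0 ≤ Skeleton.frakA χ * frakP D := mul_nonneg hA0 hfP
  have hX0 : 0 ≤ X := add_nonneg hAbs0 hfA0
  -- (1) the chain
  have h1 := hC hAss hb g hg N hN₁ hN₂
  -- (2) the band-edge absolute mean: `≤ 2·discMeanAbs⌈P⌉ + 2·block`, block `≤ (η/4)·𝔞𝔓`
  have h2a := discMeanAbs_le_two_mul_add_coefBlockMean c' χ g hM₀1 hE₁
  have h2b : coefBlockMean c' χ (profCoef D g) ⌈Skeleton.bigP D⌉₊ (bandEdge D 1078) ≤
      η / 4 * (Skeleton.frakA χ * frakP D) :=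
    hBl hAss hb g (wallZeroLip_of_glued g hg) (bandEdge D 1078) hE₁ le_rfl
  -- (3) the weight term
  have h3 : (Skeleton.ell D ^ 10)⁻¹ * (max (K : ℝ) M ^ 2 * discWeight c' χ) ≤
      η / 4 * (Skeleton.frakA χ * frakP D) := hWt hAss
  -- (4) `𝓛^{−10} ≤ min(1, η/8)`
  have hℓ10 : (Skeleton.ell D ^ 10)⁻¹ ≤ (Skeleton.ell D)⁻¹ := by
    refine inv_anti₀ hℓ0 ?_
    calc Skeleton.ell D = Skeleton.ell D ^ 1 := (pow_one _).symm
      _ ≤ Skeleton.ell D ^ 10 := pow_le_pow_right₀ hℓ1.le (by norm_num)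
  have hℓinv1 : (Skeleton.ell D)⁻¹ ≤ 1 := inv_le_one_of_one_le₀ hℓ1.le
  have hℓinvη : (Skeleton.ell D)⁻¹ ≤ η / 8 := by
    rw [inv_le_comm₀ hℓ0 (by positivity)]
    calc (η / 8)⁻¹ = 8 / η := by rw [inv_div]
      _ ≤ Skeleton.ell D := hL
  have hi0 : 0 ≤ (Skeleton.ell D ^ 10)⁻¹ := by positivity
  -- assemble
  have hbe : (Skeleton.ell D ^ 10)⁻¹ * discMeanAbs c' χ g (bandEdge D (1058 + 2 * 10)) ≤
      η / 4 * discMeanAbs c' χ g ⌈Skeleton.bigP D⌉₊ + η / 2 * (Skeleton.frakA χ * frakP D) := by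
    have e : (1058 + 2 * 10 : ℕ) = 1078 := by norm_num
    rw [e]
    calc (Skeleton.ell D ^ 10)⁻¹ * discMeanAbs c' χ g (bandEdge D 1078)
        ≤ (Skeleton.ell D ^ 10)⁻¹ * (2 * discMeanAbs c' χ g ⌈Skeleton.bigP D⌉₊ +
            2 * (η / 4 * (Skeleton.frakA χ * frakP D))) :=
          mul_le_mul_of_nonneg_left (h2a.trans (by linarith)) hi0
      _ ≤ (η / 8) * (2 * discMeanAbs c' χ g ⌈Skeleton.bigP D⌉₊) +
            1 * (2 * (η / 4 * (Skeleton.frakA χ * frakP D))) := by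
          rw [mul_add]
          exact add_le_add (mul_le_mul_of_nonneg_right (hℓ10.trans hℓinvη) (by positivity))
            (mul_le_mul_of_nonneg_right (hℓ10.trans hℓinv1) (by positivity))
      _ = η / 4 * discMeanAbs c' χ g ⌈Skeleton.bigP D⌉₊ + η / 2 * (Skeleton.frakA χ * frakP D) := by ring
  calc |discMean c' χ g N - discMean c' χ g ⌈Skeleton.bigP D⌉₊|
      ≤ η / 4 * X + (Skeleton.ell D ^ 10)⁻¹ *
          (discMeanAbs c' χ g (bandEdge D (1058 + 2 * 10)) + max (K : ℝ) M ^ 2 * discWeight c' χ) := h1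
    _ = η / 4 * X + ((Skeleton.ell D ^ 10)⁻¹ * discMeanAbs c' χ g (bandEdge D (1058 + 2 * 10)) +
          (Skeleton.ell D ^ 10)⁻¹ * (max (K : ℝ) M ^ 2 * discWeight c' χ)) := by ring
    _ ≤ η / 4 * X + ((η / 4 * discMeanAbs c' χ g ⌈Skeleton.bigP D⌉₊ + η / 2 * (Skeleton.frakA χ * frakP D)) +
          η / 4 * (Skeleton.frakA χ * frakP D)) := by
        have := add_le_add hbe h3
        linarith
    _ ≤ η * X := by rw [hX]; nlinarith

/-- **THE CLEAN FROM-THE-WALL THEOREM (top-vanishing profile, every length).** As `discMean_fromWall_of_bandMeanValue`,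
for a profile of `GluedWallZeroClass K M` that VANISHES on `[θ, ∞)`: every `N ≥ ⌈P⌉` (the polynomial is constant from
`⌈P^{|θ−1|+2}⌉` on). [cite: Zhang2022LandauSiegel, §2 (2.16)–(2.20), (2.30)–(2.31); §8 Lemma 8.1] -/
theorem discMean_fromWall_topVanishing_of_bandMeanValue (c' : ℝ) (θ : ℝ) (K : ℝ≥0) (M : ℝ) {κ η : ℝ}
    (hκ : κ < 6) (hη : 0 < η) (hB : BandMeanValue c' 1078 κ) (h71 : Prop71 c') (h81 : Lemma81 c')
    (h22 : Prop22i) (h23 : Lemma23 c') :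
    Skeleton.ForAllLarge fun D _ χ => Skeleton.AssumptionA D χ →
      (∀ i ∈ Skeleton.idx χ, (i.2).re = 1 / 2) →
        ∀ g : ℝ → ℂ, GluedWallZeroClass K M g → (∀ z, θ ≤ z → g z = 0) → ∀ N : ℕ, ⌈Skeleton.bigP D⌉₊ ≤ N →
          |discMean c' χ g N - discMean c' χ g ⌈Skeleton.bigP D⌉₊| ≤
            η * (discMeanAbs c' χ g ⌈Skeleton.bigP D⌉₊ + Skeleton.frakA χ * frakP D) := by
  have hδ : 0 < |θ - 1| + 1 := by have := abs_nonneg (θ - 1); linarith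
  have hθ : θ ≤ 1 + (|θ - 1| + 1) := by have := le_abs_self (θ - 1); linarith
  refine ((discMean_fromWall_of_bandMeanValue c' hδ K M hκ hη hB h71 h81 h22 h23).and
      (Skeleton.ForAllLarge.of_le 3 fun D _ _ hD _ _ => hD)).mono ?_
  intro D _ χ _ _ h hAss hb g hg hg0 N hN₁
  obtain ⟨hwall, hD3⟩ := h
  by_cases hNδ : N ≤ ⌈Skeleton.bigP D ^ (1 + (|θ - 1| + 1))⌉₊
  · exact hwall hAss hb g hg N hN₁ hNδ
  · have hNδ' : ⌈Skeleton.bigP D ^ (1 + (|θ - 1| + 1))⌉₊ ≤ N := (not_le.mp hNδ).le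
    have hℓ0 : 0 < Skeleton.ell D := zero_lt_one.trans (Skeleton.one_lt_ell hD3)
    have hP : 0 < Skeleton.bigP D := Real.exp_pos _
    have hlogPpos : 0 < Real.log (Skeleton.bigP D) := by
      rw [Skeleton.bigP, Real.log_exp]; exact pow_pos hℓ0 9
    have hNδ1 : 1 ≤ ⌈Skeleton.bigP D ^ (1 + (|θ - 1| + 1))⌉₊ :=
      Nat.one_le_ceil_iff.mpr (Real.rpow_pos_of_pos hP _)
    have hpoly : ∀ (x : Skeleton.Chr D) (s : ℂ),
        profPoly χ x g N s = profPoly χ x g ⌈Skeleton.bigP D ^ (1 + (|θ - 1| + 1))⌉₊ s := by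
      intro x s
      rw [profPoly_eq_add_coefBlock χ x g hNδ1 hNδ' s]
      have hzero : coefBlock χ x (profCoef D g) ⌈Skeleton.bigP D ^ (1 + (|θ - 1| + 1))⌉₊ N s = 0 := by
        refine Finset.sum_eq_zero fun n hn => ?_
        have hn : ⌈Skeleton.bigP D ^ (1 + (|θ - 1| + 1))⌉₊ ≤ n := (Finset.mem_Ico.mp hn).1
        have hnr : Skeleton.bigP D ^ (1 + (|θ - 1| + 1)) ≤ (n : ℝ) :=
          (Nat.le_ceil _).trans (by exact_mod_cast hn)
        have hθn : θ ≤ Real.log n / Real.log (Skeleton.bigP D) := by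
          rw [le_div_iff₀ hlogPpos]
          have h1 := Real.log_le_log (Real.rpow_pos_of_pos hP _) hnr
          rw [Real.log_rpow hP] at h1
          calc θ * Real.log (Skeleton.bigP D) ≤ (1 + (|θ - 1| + 1)) * Real.log (Skeleton.bigP D) :=
                mul_le_mul_of_nonneg_right hθ hlogPpos.le
            _ ≤ Real.log n := h1
        simp only [profCoef]
        rw [hg0 _ hθn]; ring
      rw [hzero, add_zero]
    have hmean : discMean c' χ g N = discMean c' χ g ⌈Skeleton.bigP D ^ (1 + (|θ - 1| + 1))⌉₊ := by
      simp only [discMean, hpoly]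
    rw [hmean]
    have hPle : ⌈Skeleton.bigP D⌉₊ ≤ ⌈Skeleton.bigP D ^ (1 + (|θ - 1| + 1))⌉₊ := by
      refine Nat.ceil_mono ?_
      have hP1 : 1 ≤ Skeleton.bigP D := by
        rw [Skeleton.bigP]; exact Real.one_le_exp (pow_nonneg hℓ0.le 9)
      calc Skeleton.bigP D = Skeleton.bigP D ^ (1:ℝ) := (Real.rpow_one _).symm
        _ ≤ Skeleton.bigP D ^ (1 + (|θ - 1| + 1)) := Real.rpow_le_rpow_of_exponent_le hP1 (by linarith)
    exact hwall hAss hb g hg _ hPle le_rfl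

/-! ### Part 3 — rows: the wall-zero design types of p459259 -/

/-- **Verdict (band mean-value form)** for a wall-value-zero design `(c′, g)`: for every `δ > 0`, `η > 0`, `κ < 6`,
GIVEN the large-sieve-type slot `BandMeanValue c′ 1078 κ` (kind (c)) and the manuscript's nodes Prop 7.1, Lemma 8.1,
Prop 2.2 (i), Lemma 2.3 (displayed), for all large `D`, under (A) and (b), for EVERY `⌈P⌉ ≤ N ≤ ⌈P^{1+δ}⌉`:
`¬ (η·(discMeanAbs⌈P⌉ + 𝔞𝔓) < |discMean N − discMean ⌈P⌉|)` — no main-order movement from the wall to any length.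
[cite: Zhang2022LandauSiegel, §2 (2.16)–(2.20), (2.30)–(2.31); §7 Prop 7.1; §8 Lemma 8.1] -/
def WallZeroDesign.VerdictBandMV (d : WallZeroDesign) : Prop :=
  ∀ ⦃δ : ℝ⦄, 0 < δ → ∀ ⦃η κ : ℝ⦄, 0 < η → κ < 6 → BandMeanValue d.c' 1078 κ →
    Prop71 d.c' → Lemma81 d.c' → Prop22i → Lemma23 d.c' →
      Skeleton.ForAllLarge fun D _ χ => Skeleton.AssumptionA D χ →
        (∀ i ∈ Skeleton.idx χ, (i.2).re = 1 / 2) →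
          ∀ N : ℕ, ⌈Skeleton.bigP D⌉₊ ≤ N → N ≤ ⌈Skeleton.bigP D ^ (1 + δ)⌉₊ →
            ¬ (η * (discMeanAbs d.c' χ d.g ⌈Skeleton.bigP D⌉₊ + Skeleton.frakA χ * frakP D) <
                |discMean d.c' χ d.g N - discMean d.c' χ d.g ⌈Skeleton.bigP D⌉₊|)

/-- A wall-value-zero design (globally 1-Lipschitz, `‖g‖ ≤ 1`, `g(1) = 0`) is in the glued class with `K = M = 1`.
[cite: Zhang2022LandauSiegel, §7 (7.2) p.44] -/
theorem gluedWallZeroClass_of_wallZero (d : WallZeroDesign) (h : d.InClass) : GluedWallZeroClass 1 1 d.g :=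
  ⟨h.1.lipschitzOnWith, fun z _ => h.2.1 z, h.2.2⟩

/-- **The slice theorem (band mean-value form).** [cite: Zhang2022LandauSiegel, §2 (2.16)–(2.20); §7 Prop 7.1; §8 Lemma 8.1] -/
theorem WallZeroDesign.verdictBandMV_of_inClass (d : WallZeroDesign) (h : d.InClass) : d.VerdictBandMV := by
  intro δ hδ η κ hη hκ hB h71 h81 h22 h23
  refine (discMean_fromWall_of_bandMeanValue d.c' hδ 1 1 hκ hη hB h71 h81 h22 h23).mono ?_
  intro D _ χ _ _ hflat hAss hb N hN₁ hN₂
  exact not_lt.2 (hflat hAss hb d.g (gluedWallZeroClass_of_wallZero d h) N hN₁ hN₂)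

/-- family «wall value zero, from the wall to any bounded length; slot = E-004′(κ) `BandMeanValue` (κ < 6) + the four
mean-value nodes; verdict in the clean form `η·(discMeanAbs⌈P⌉ + 𝔞𝔓)`».
[cite: Zhang2022LandauSiegel, §2 (2.16)–(2.20), (2.30); §7 Prop 7.1; §8 Lemma 8.1] -/
def familyWallZeroBandMV : DesignFamily where
  Design := WallZeroDesign
  InClass := WallZeroDesign.InClass
  Verdict := WallZeroDesign.VerdictBandMV

/-- **`familyWallZeroBandMV` is decided.** [cite: Zhang2022LandauSiegel, §2 (2.16)–(2.20); §7 Prop 7.1; §8 Lemma 8.1] -/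
theorem familyWallZeroBandMV_decided : familyWallZeroBandMV.Decided :=
  fun d h => WallZeroDesign.verdictBandMV_of_inClass d h

/-- **Verdict (band mean-value form, top-vanishing)**: the FULL polynomial, every `N ≥ ⌈P⌉`.
[cite: Zhang2022LandauSiegel, §2 (2.16)–(2.20), (2.30)–(2.31); §7 Prop 7.1; §8 Lemma 8.1] -/
def WallZeroTopDesign.VerdictBandMV (d : WallZeroTopDesign) : Prop :=
  ∀ ⦃η κ : ℝ⦄, 0 < η → κ < 6 → BandMeanValue d.c' 1078 κ →
    Prop71 d.c' → Lemma81 d.c' → Prop22i → Lemma23 d.c' →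
      Skeleton.ForAllLarge fun D _ χ => Skeleton.AssumptionA D χ →
        (∀ i ∈ Skeleton.idx χ, (i.2).re = 1 / 2) →
          ∀ N : ℕ, ⌈Skeleton.bigP D⌉₊ ≤ N →
            ¬ (η * (discMeanAbs d.c' χ d.g ⌈Skeleton.bigP D⌉₊ + Skeleton.frakA χ * frakP D) <
                |discMean d.c' χ d.g N - discMean d.c' χ d.g ⌈Skeleton.bigP D⌉₊|)

/-- **The slice theorem (band mean-value form, top-vanishing).** [cite: Zhang2022LandauSiegel, §2 (2.16)–(2.20); §7 Prop 7.1; §8 Lemma 8.1] -/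
theorem WallZeroTopDesign.verdictBandMV_of_inClass (d : WallZeroTopDesign) (h : d.InClass) :
    d.VerdictBandMV := by
  intro η κ hη hκ hB h71 h81 h22 h23
  refine (discMean_fromWall_topVanishing_of_bandMeanValue d.c' d.θ 1 1 hκ hη hB h71 h81 h22 h23).mono ?_
  intro D _ χ _ _ hflat hAss hb N hN₁
  exact not_lt.2 (hflat hAss hb d.g (gluedWallZeroClass_of_wallZero d.toWallZeroDesign h.1) h.2 N hN₁)

/-- family «wall value zero, top-vanishing, full polynomial vs bulk; slot = E-004′(κ) + the four nodes; clean verdict».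
[cite: Zhang2022LandauSiegel, §2 (2.16)–(2.20), (2.30); §7 Prop 7.1; §8 Lemma 8.1] -/
def familyWallZeroTopBandMV : DesignFamily where
  Design := WallZeroTopDesign
  InClass := WallZeroTopDesign.InClass
  Verdict := WallZeroTopDesign.VerdictBandMV

/-- **`familyWallZeroTopBandMV` is decided.** [cite: Zhang2022LandauSiegel, §2 (2.16)–(2.20); §7 Prop 7.1; §8 Lemma 8.1] -/
theorem familyWallZeroTopBandMV_decided : familyWallZeroTopBandMV.Decided :=
  fun d h => WallZeroTopDesign.verdictBandMV_of_inClass d h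

/-! ### Part 4 — rows: the smooth design types of p457377 with wall value zero (glued class, ANY bulk) -/

/-- **Verdict (band mean-value form, glued class, bounded lengths)** for a smooth design `(c′, K, M, g)` with `g(1) = 0`.
[cite: Zhang2022LandauSiegel, §2 (2.16)–(2.20), (2.30)–(2.31); §7 Prop 7.1; §8 Lemma 8.1] -/
def SmoothDesign.VerdictBandMV (d : SmoothDesign) : Prop :=
  ∀ ⦃δ : ℝ⦄, 0 < δ → ∀ ⦃η κ : ℝ⦄, 0 < η → κ < 6 → BandMeanValue d.c' 1078 κ →
    Prop71 d.c' → Lemma81 d.c' → Prop22i → Lemma23 d.c' →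
      Skeleton.ForAllLarge fun D _ χ => Skeleton.AssumptionA D χ →
        (∀ i ∈ Skeleton.idx χ, (i.2).re = 1 / 2) →
          ∀ N : ℕ, ⌈Skeleton.bigP D⌉₊ ≤ N → N ≤ ⌈Skeleton.bigP D ^ (1 + δ)⌉₊ →
            ¬ (η * (discMeanAbs d.c' χ d.g ⌈Skeleton.bigP D⌉₊ + Skeleton.frakA χ * frakP D) <
                |discMean d.c' χ d.g N - discMean d.c' χ d.g ⌈Skeleton.bigP D⌉₊|)

/-- The slice theorem (glued class, bounded lengths). [cite: Zhang2022LandauSiegel, §2 (2.16)–(2.20); §7 Prop 7.1; §8 Lemma 8.1] -/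
theorem SmoothDesign.verdictBandMV_of_inClassWall0 (d : SmoothDesign) (h : d.InClass) (h0 : d.g 1 = 0) :
    d.VerdictBandMV := by
  intro δ hδ η κ hη hκ hB h71 h81 h22 h23
  refine (discMean_fromWall_of_bandMeanValue d.c' hδ d.K d.M hκ hη hB h71 h81 h22 h23).mono ?_
  intro D _ χ _ _ hflat hAss hb N hN₁ hN₂
  exact not_lt.2 (hflat hAss hb d.g ⟨h.1, h.2, h0⟩ N hN₁ hN₂)

/-- family «smooth design (any bulk, `K`-Lipschitz `‖·‖ ≤ M` overhang), wall value zero, from the wall to any bounded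
length; slot = E-004′(κ) + the four nodes; clean verdict» (class = row 37's, `familySmoothWallZeroTrueBand`, literally).
[cite: Zhang2022LandauSiegel, §2 (2.16)–(2.20), (2.30); §7 Prop 7.1; §8 Lemma 8.1] -/
def familySmoothWallZeroBandMV : DesignFamily where
  Design := SmoothDesign
  InClass d := d.InClass ∧ d.g 1 = 0
  Verdict := SmoothDesign.VerdictBandMV

/-- Same class as row 37 (`familySmoothWallZeroTrueBand`, p471890). [cite: Zhang2022LandauSiegel, §7 (7.2) p.44] -/
theorem familySmoothWallZeroBandMV_inClass_iff (d : SmoothDesign) :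
    familySmoothWallZeroBandMV.InClass d ↔ familySmoothWallZeroTrueBand.InClass d := Iff.rfl

/-- **`familySmoothWallZeroBandMV` is decided.** [cite: Zhang2022LandauSiegel, §2 (2.16)–(2.20); §7 Prop 7.1; §8 Lemma 8.1] -/
theorem familySmoothWallZeroBandMV_decided : familySmoothWallZeroBandMV.Decided :=
  fun d h => SmoothDesign.verdictBandMV_of_inClassWall0 d h.1 h.2

/-- **Verdict (band mean-value form, glued class, top-vanishing, full polynomial)**: every `N ≥ ⌈P⌉`.
[cite: Zhang2022LandauSiegel, §2 (2.16)–(2.20), (2.30)–(2.31); §7 Prop 7.1; §8 Lemma 8.1] -/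
def SmoothTopDesign.VerdictBandMV (d : SmoothTopDesign) : Prop :=
  ∀ ⦃η κ : ℝ⦄, 0 < η → κ < 6 → BandMeanValue d.c' 1078 κ →
    Prop71 d.c' → Lemma81 d.c' → Prop22i → Lemma23 d.c' →
      Skeleton.ForAllLarge fun D _ χ => Skeleton.AssumptionA D χ →
        (∀ i ∈ Skeleton.idx χ, (i.2).re = 1 / 2) →
          ∀ N : ℕ, ⌈Skeleton.bigP D⌉₊ ≤ N →
            ¬ (η * (discMeanAbs d.c' χ d.g ⌈Skeleton.bigP D⌉₊ + Skeleton.frakA χ * frakP D) <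
                |discMean d.c' χ d.g N - discMean d.c' χ d.g ⌈Skeleton.bigP D⌉₊|)

/-- The slice theorem (glued class, top-vanishing). [cite: Zhang2022LandauSiegel, §2 (2.16)–(2.20); §7 Prop 7.1; §8 Lemma 8.1] -/
theorem SmoothTopDesign.verdictBandMV_of_inClassWall0 (d : SmoothTopDesign) (h : d.InClass) (h0 : d.g 1 = 0) :
    d.VerdictBandMV := by
  intro η κ hη hκ hB h71 h81 h22 h23
  refine (discMean_fromWall_topVanishing_of_bandMeanValue d.c' d.θ d.K d.M hκ hη hB h71 h81 h22 h23).mono ?_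
  intro D _ χ _ _ hflat hAss hb N hN₁
  exact not_lt.2 (hflat hAss hb d.g ⟨h.1.1, h.1.2, h0⟩ h.2 N hN₁)

/-- family «smooth top-vanishing design (any bulk), wall value zero, full polynomial vs bulk; slot = E-004′(κ) + the
four nodes; clean verdict» (class = row 38's, `familySmoothTopWallZeroTrueBand`, literally).
[cite: Zhang2022LandauSiegel, §2 (2.16)–(2.20), (2.30); §7 Prop 7.1; §8 Lemma 8.1] -/
def familySmoothTopWallZeroBandMV : DesignFamily where
  Design := SmoothTopDesign
  InClass d := d.InClass ∧ d.g 1 = 0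
  Verdict := SmoothTopDesign.VerdictBandMV

/-- Same class as row 38 (`familySmoothTopWallZeroTrueBand`, p471890). [cite: Zhang2022LandauSiegel, §7 (7.2) p.44] -/
theorem familySmoothTopWallZeroBandMV_inClass_iff (d : SmoothTopDesign) :
    familySmoothTopWallZeroBandMV.InClass d ↔ familySmoothTopWallZeroTrueBand.InClass d := Iff.rfl

/-- **`familySmoothTopWallZeroBandMV` is decided.** [cite: Zhang2022LandauSiegel, §2 (2.16)–(2.20); §7 Prop 7.1; §8 Lemma 8.1] -/
theorem familySmoothTopWallZeroBandMV_decided : familySmoothTopWallZeroBandMV.Decided :=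
  fun d h => SmoothTopDesign.verdictBandMV_of_inClassWall0 d h.1 h.2

/-! ### C2 / C4 by name, and the `R⁺⁺`-step -/

/-- C4: the triangular overhang is a member of both wall-zero rows (same classes as p459259 / rows 35–36).
[cite: Zhang2022LandauSiegel, §7 (7.2) p.44] -/
theorem familyWallZeroBandMV_inClass_triangle (c' : ℝ) {θ : ℝ} (hθ : 1 ≤ θ) (hθ3 : θ ≤ 3) :
    familyWallZeroBandMV.InClass (WallZeroDesign.mk c' fun y => ((max 0 (min (y - 1) (θ - y)) : ℝ) : ℂ)) ∧
      familyWallZeroTopBandMV.InClass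
        (WallZeroTopDesign.mk ⟨c', fun y => ((max 0 (min (y - 1) (θ - y)) : ℝ) : ℂ)⟩ θ) :=
  ⟨inClass_triangle c' hθ hθ3, inClassTop_triangle c' hθ hθ3⟩

/-- C2: every wall-value-zero design of p459259 is a member of the glued row with `K = M = 1`; C4: the glued class-text
design `u ⊕ v` with ANY bulk `u` is a member of the glued top row (`inClassWall0_ofWallZero`, `inClassWall0_glue` of
p471890, same classes). [cite: Zhang2022LandauSiegel, §7 (7.2) p.44] -/
theorem familySmoothWallZeroBandMV_members (d : WallZeroDesign) (h : d.InClass) (c' : ℝ) {θ : ℝ} (hθ : 1 ≤ θ)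
    (u v : ℝ → ℂ) {K : ℝ≥0} {M : ℝ} (hv : LipschitzOnWith K v (Set.Icc 1 θ))
    (hM : ∀ z ∈ Set.Icc 1 θ, ‖v z‖ ≤ M) (hwall : v 1 = 0) (htop : v θ = 0) :
    familySmoothWallZeroBandMV.InClass (SmoothDesign.mk d.c' 1 1 d.g) ∧
      familySmoothTopWallZeroBandMV.InClass
        (SmoothTopDesign.mk ⟨c', K, M, fun z => if z < 1 then u z else v (min z θ)⟩ θ) :=
  ⟨inClassWall0_ofWallZero d h, inClassWall0_glue c' hθ u v hv hM hwall htop⟩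

/-- **`R⁺⁺`-step of this file**:
`ClassDecided (Rplus ++ [familyWallZeroBandMV, familyWallZeroTopBandMV, familySmoothWallZeroBandMV, familySmoothTopWallZeroBandMV])`.
[cite: Zhang2022LandauSiegel, §2 (2.32)–(2.33); §7 (7.2) p.44] -/
theorem rplus_bandMV_decided :
    ClassDecided (Rplus ++ [familyWallZeroBandMV, familyWallZeroTopBandMV, familySmoothWallZeroBandMV,
      familySmoothTopWallZeroBandMV]) :=
  classDecided_append.2
    ⟨rplus_decided, classDecided_cons familyWallZeroBandMV_decided
      (classDecided_cons familyWallZeroTopBandMV_decided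
        (classDecided_cons familySmoothWallZeroBandMV_decided
          (classDecided_cons familySmoothTopWallZeroBandMV_decided classDecided_nil)))⟩

/-! ### Part 5 (v2) — engines from a CLASS-RESTRICTED slot `BandMeanValueOn 𝒞`, `𝒞 ⊇ profCoefClass K` -/

/-- **The band block is `o(𝔞𝔓)` given a class-restricted slot** (`𝒞 ⊇` the profile coefficients of `WallZeroLip K`),
`κ < 6`, the four nodes, under (A) and (b). [cite: Zhang2022LandauSiegel, §2 (2.16), (2.30)–(2.31); §7 Prop 7.1; §8 Lemma 8.1] -/
theorem coefBlockMean_profCoef_le_of_bandMeanValueOn {𝒞 : ℕ → (ℕ → ℂ) → Prop} (c' : ℝ) (m : ℕ) (K : ℝ≥0)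
    {κ ε : ℝ} (hκ : κ < 6) (hε : 0 < ε) (h𝒞 : ∀ (D : ℕ) (g : ℝ → ℂ), WallZeroLip K g → 𝒞 D (profCoef D g))
    (hB : BandMeanValueOn 𝒞 c' m κ) (h71 : Prop71 c') (h81 : Lemma81 c') (h22 : Prop22i) (h23 : Lemma23 c') :
    Skeleton.ForAllLarge fun D _ χ => Skeleton.AssumptionA D χ →
      (∀ i ∈ Skeleton.idx χ, (i.2).re = 1 / 2) →
        ∀ g : ℝ → ℂ, WallZeroLip K g → ∀ N : ℕ, ⌈Skeleton.bigP D⌉₊ ≤ N → N ≤ bandEdge D m →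
          coefBlockMean c' χ (profCoef D g) ⌈Skeleton.bigP D⌉₊ N ≤ ε * (Skeleton.frakA χ * frakP D) := by
  obtain ⟨a₀, ha₀, hA⟩ := frakALowerBound_holds
  have hW := Skeleton.discWeight_trivialScale_window c' h71 h81 h22 h23
  set C : ℝ := 3 * ((K : ℝ) ^ 2 * ((m : ℝ) + 3) ^ 3) with hCdef
  have hroom := loss_le_room_eventually hκ C (ε := ε * a₀) (by positivity)
  refine ((((hB.and hW).and hA).and ((coefBlockMass_profCoef_le m).and hroom)).and
    (forAllLarge_three_le_and_le_ell 1)).mono ?_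
  intro D _ χ _ _ h hAss hb g hg N hN₁ hN₂
  obtain ⟨⟨⟨⟨hBD, hWD⟩, hAD⟩, hMD, hRD⟩, hD3, -⟩ := h
  have hℓ0 : 0 < Skeleton.ell D := zero_lt_one.trans (Skeleton.one_lt_ell hD3)
  have hfP : 0 ≤ frakP D := frakP_nonneg D
  have hκ0 : 0 ≤ Skeleton.ell D ^ κ := Real.rpow_nonneg hℓ0.le κ
  have h1 := hBD hb (profCoef D g) (h𝒞 D g hg) N hN₁ hN₂
  have h2 := hMD K g hg N hN₁ hN₂
  have h3 : discWeight c' χ ≤ 3 * Skeleton.ell D ^ 9 * frakP D := (hWD hAss).2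
  have h4 : a₀ ≤ Skeleton.frakA χ := hAD hAss
  have hstep : coefBlockMean c' χ (profCoef D g) ⌈Skeleton.bigP D⌉₊ N ≤
      Skeleton.ell D ^ κ * (3 * Skeleton.ell D ^ 9 * frakP D) *
        ((K : ℝ) ^ 2 * ((m : ℝ) + 3) ^ 3 * (Skeleton.ell D ^ 15)⁻¹) := by
    refine h1.trans (mul_le_mul ?_ h2 (coefBlockMass_nonneg _ _ _) (mul_nonneg hκ0 (by positivity)))
    exact mul_le_mul_of_nonneg_left h3 hκ0
  have hid : Skeleton.ell D ^ κ * (3 * Skeleton.ell D ^ 9 * frakP D) *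
      ((K : ℝ) ^ 2 * ((m : ℝ) + 3) ^ 3 * (Skeleton.ell D ^ 15)⁻¹) =
      (C * Skeleton.ell D ^ κ) * (frakP D * (Skeleton.ell D ^ 9 * (Skeleton.ell D ^ 15)⁻¹)) := by
    rw [hCdef]; ring
  have hid2 : ε * a₀ * Skeleton.ell D ^ 6 * (frakP D * (Skeleton.ell D ^ 9 * (Skeleton.ell D ^ 15)⁻¹)) =
      ε * (a₀ * frakP D) := by
    field_simp
  calc coefBlockMean c' χ (profCoef D g) ⌈Skeleton.bigP D⌉₊ N
      ≤ (C * Skeleton.ell D ^ κ) * (frakP D * (Skeleton.ell D ^ 9 * (Skeleton.ell D ^ 15)⁻¹)) := hstep.trans hid.le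
    _ ≤ (ε * a₀ * Skeleton.ell D ^ 6) * (frakP D * (Skeleton.ell D ^ 9 * (Skeleton.ell D ^ 15)⁻¹)) :=
        mul_le_mul_of_nonneg_right hRD (by positivity)
    _ = ε * (a₀ * frakP D) := hid2
    _ ≤ ε * (Skeleton.frakA χ * frakP D) :=
        mul_le_mul_of_nonneg_left (mul_le_mul_of_nonneg_right h4 hfP) hε.le

/-- **THE CLEAN FROM-THE-WALL THEOREM from a class-restricted slot (bounded lengths).** As
`discMean_fromWall_of_bandMeanValue`, with `BandMeanValueOn 𝒞 c′ 1078 κ` for any `𝒞 ⊇ profCoefClass K` in place of the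
all-coefficients slot. [cite: Zhang2022LandauSiegel, §2 (2.16)–(2.20), (2.30)–(2.31), Lemma 2.3; §5 Lemma 5.7; §7 Prop 7.1; §8 Lemma 8.1] -/
theorem discMean_fromWall_of_bandMeanValueOn {𝒞 : ℕ → (ℕ → ℂ) → Prop} (c' : ℝ) {δ : ℝ} (hδ : 0 < δ) (K : ℝ≥0)
    (M : ℝ) {κ η : ℝ} (hκ : κ < 6) (hη : 0 < η)
    (h𝒞 : ∀ (D : ℕ) (g : ℝ → ℂ), WallZeroLip K g → 𝒞 D (profCoef D g)) (hB : BandMeanValueOn 𝒞 c' 1078 κ)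
    (h71 : Prop71 c') (h81 : Lemma81 c') (h22 : Prop22i) (h23 : Lemma23 c') :
    Skeleton.ForAllLarge fun D _ χ => Skeleton.AssumptionA D χ →
      (∀ i ∈ Skeleton.idx χ, (i.2).re = 1 / 2) →
        ∀ g : ℝ → ℂ, GluedWallZeroClass K M g → ∀ N : ℕ, ⌈Skeleton.bigP D⌉₊ ≤ N →
          N ≤ ⌈Skeleton.bigP D ^ (1 + δ)⌉₊ →
            |discMean c' χ g N - discMean c' χ g ⌈Skeleton.bigP D⌉₊| ≤
              η * (discMeanAbs c' χ g ⌈Skeleton.bigP D⌉₊ + Skeleton.frakA χ * frakP D) := by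
  have hη4 : 0 < η / 4 := by positivity
  have hslot : DiscMeanTrueBandAOn (GluedWallZeroClass K M) c' (1058 + 2 * 10) (η / 4) :=
    (discMeanTrueBandAOn_wallZeroLip_of_bandMeanValueOn c' 1078 K hκ hη4 h𝒞 hB h71 h81 h22 h23).anti
      fun g hg => wallZeroLip_of_glued g hg
  have hchain := discMean_fromWall_of_trueBandAOn_KM c' hδ 10 (gluedClass_restrict' K M) hslot
  have hblock := coefBlockMean_profCoef_le_of_bandMeanValueOn c' 1078 K hκ hη4 h𝒞 hB h71 h81 h22 h23
  have hweight := inv_ell_pow_ten_mul_discWeight_le c' (max (K : ℝ) M ^ 2) hη4 h71 h81 h22 h23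
  refine (((hchain.and hblock).and hweight).and (forAllLarge_three_le_and_le_ell (8 / η))).mono ?_
  intro D _ χ _ _ h hAss hb g hg N hN₁ hN₂
  obtain ⟨⟨⟨hC, hBl⟩, hWt⟩, hD3, hL⟩ := h
  have hA0 : 0 ≤ Skeleton.frakA χ := Skeleton.frakA_nonneg χ
  have hℓ1 : 1 < Skeleton.ell D := Skeleton.one_lt_ell hD3
  have hℓ0 : 0 < Skeleton.ell D := zero_lt_one.trans hℓ1
  have hfP : 0 ≤ frakP D := frakP_nonneg D
  have hP0 : 0 < Skeleton.bigP D := Real.exp_pos _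
  have hM₀1 : 1 ≤ ⌈Skeleton.bigP D⌉₊ := Nat.one_le_ceil_iff.mpr hP0
  have hE₁ : ⌈Skeleton.bigP D⌉₊ ≤ bandEdge D 1078 := ceil_bigP_le_bandEdge hD3 _
  set X : ℝ := discMeanAbs c' χ g ⌈Skeleton.bigP D⌉₊ + Skeleton.frakA χ * frakP D with hX
  have hAbs0 : 0 ≤ discMeanAbs c' χ g ⌈Skeleton.bigP D⌉₊ := discMeanAbs_nonneg c' χ g _
  have hfA0 : 0 ≤ Skeleton.frakA χ * frakP D := mul_nonneg hA0 hfP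
  have hX0 : 0 ≤ X := add_nonneg hAbs0 hfA0
  have h1 := hC hAss hb g hg N hN₁ hN₂
  have h2a := discMeanAbs_le_two_mul_add_coefBlockMean c' χ g hM₀1 hE₁
  have h2b : coefBlockMean c' χ (profCoef D g) ⌈Skeleton.bigP D⌉₊ (bandEdge D 1078) ≤
      η / 4 * (Skeleton.frakA χ * frakP D) :=
    hBl hAss hb g (wallZeroLip_of_glued g hg) (bandEdge D 1078) hE₁ le_rfl
  have h3 : (Skeleton.ell D ^ 10)⁻¹ * (max (K : ℝ) M ^ 2 * discWeight c' χ) ≤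
      η / 4 * (Skeleton.frakA χ * frakP D) := hWt hAss
  have hℓ10 : (Skeleton.ell D ^ 10)⁻¹ ≤ (Skeleton.ell D)⁻¹ := by
    refine inv_anti₀ hℓ0 ?_
    calc Skeleton.ell D = Skeleton.ell D ^ 1 := (pow_one _).symm
      _ ≤ Skeleton.ell D ^ 10 := pow_le_pow_right₀ hℓ1.le (by norm_num)
  have hℓinv1 : (Skeleton.ell D)⁻¹ ≤ 1 := inv_le_one_of_one_le₀ hℓ1.le
  have hℓinvη : (Skeleton.ell D)⁻¹ ≤ η / 8 := by
    rw [inv_le_comm₀ hℓ0 (by positivity)]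
    calc (η / 8)⁻¹ = 8 / η := by rw [inv_div]
      _ ≤ Skeleton.ell D := hL
  have hi0 : 0 ≤ (Skeleton.ell D ^ 10)⁻¹ := by positivity
  have hbe : (Skeleton.ell D ^ 10)⁻¹ * discMeanAbs c' χ g (bandEdge D (1058 + 2 * 10)) ≤
      η / 4 * discMeanAbs c' χ g ⌈Skeleton.bigP D⌉₊ + η / 2 * (Skeleton.frakA χ * frakP D) := by
    have e : (1058 + 2 * 10 : ℕ) = 1078 := by norm_num
    rw [e]
    calc (Skeleton.ell D ^ 10)⁻¹ * discMeanAbs c' χ g (bandEdge D 1078)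
        ≤ (Skeleton.ell D ^ 10)⁻¹ * (2 * discMeanAbs c' χ g ⌈Skeleton.bigP D⌉₊ +
            2 * (η / 4 * (Skeleton.frakA χ * frakP D))) :=
          mul_le_mul_of_nonneg_left (h2a.trans (by linarith)) hi0
      _ ≤ (η / 8) * (2 * discMeanAbs c' χ g ⌈Skeleton.bigP D⌉₊) +
            1 * (2 * (η / 4 * (Skeleton.frakA χ * frakP D))) := by
          rw [mul_add]
          exact add_le_add (mul_le_mul_of_nonneg_right (hℓ10.trans hℓinvη) (by positivity))
            (mul_le_mul_of_nonneg_right (hℓ10.trans hℓinv1) (by positivity))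
      _ = η / 4 * discMeanAbs c' χ g ⌈Skeleton.bigP D⌉₊ + η / 2 * (Skeleton.frakA χ * frakP D) := by ring
  calc |discMean c' χ g N - discMean c' χ g ⌈Skeleton.bigP D⌉₊|
      ≤ η / 4 * X + (Skeleton.ell D ^ 10)⁻¹ *
          (discMeanAbs c' χ g (bandEdge D (1058 + 2 * 10)) + max (K : ℝ) M ^ 2 * discWeight c' χ) := h1
    _ = η / 4 * X + ((Skeleton.ell D ^ 10)⁻¹ * discMeanAbs c' χ g (bandEdge D (1058 + 2 * 10)) +
          (Skeleton.ell D ^ 10)⁻¹ * (max (K : ℝ) M ^ 2 * discWeight c' χ)) := by ring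
    _ ≤ η / 4 * X + ((η / 4 * discMeanAbs c' χ g ⌈Skeleton.bigP D⌉₊ + η / 2 * (Skeleton.frakA χ * frakP D)) +
          η / 4 * (Skeleton.frakA χ * frakP D)) := by
        have := add_le_add hbe h3
        linarith
    _ ≤ η * X := by rw [hX]; nlinarith

/-- **THE CLEAN FROM-THE-WALL THEOREM from a class-restricted slot (top-vanishing, every length).**
[cite: Zhang2022LandauSiegel, §2 (2.16)–(2.20), (2.30)–(2.31); §8 Lemma 8.1] -/
theorem discMean_fromWall_topVanishing_of_bandMeanValueOn {𝒞 : ℕ → (ℕ → ℂ) → Prop} (c' : ℝ) (θ : ℝ) (K : ℝ≥0)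
    (M : ℝ) {κ η : ℝ} (hκ : κ < 6) (hη : 0 < η)
    (h𝒞 : ∀ (D : ℕ) (g : ℝ → ℂ), WallZeroLip K g → 𝒞 D (profCoef D g)) (hB : BandMeanValueOn 𝒞 c' 1078 κ)
    (h71 : Prop71 c') (h81 : Lemma81 c') (h22 : Prop22i) (h23 : Lemma23 c') :
    Skeleton.ForAllLarge fun D _ χ => Skeleton.AssumptionA D χ →
      (∀ i ∈ Skeleton.idx χ, (i.2).re = 1 / 2) →
        ∀ g : ℝ → ℂ, GluedWallZeroClass K M g → (∀ z, θ ≤ z → g z = 0) → ∀ N : ℕ, ⌈Skeleton.bigP D⌉₊ ≤ N →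
          |discMean c' χ g N - discMean c' χ g ⌈Skeleton.bigP D⌉₊| ≤
            η * (discMeanAbs c' χ g ⌈Skeleton.bigP D⌉₊ + Skeleton.frakA χ * frakP D) := by
  have hδ : 0 < |θ - 1| + 1 := by have := abs_nonneg (θ - 1); linarith
  have hθ : θ ≤ 1 + (|θ - 1| + 1) := by have := le_abs_self (θ - 1); linarith
  refine ((discMean_fromWall_of_bandMeanValueOn c' hδ K M hκ hη h𝒞 hB h71 h81 h22 h23).and
      (Skeleton.ForAllLarge.of_le 3 fun D _ _ hD _ _ => hD)).mono ?_
  intro D _ χ _ _ h hAss hb g hg hg0 N hN₁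
  obtain ⟨hwall, hD3⟩ := h
  by_cases hNδ : N ≤ ⌈Skeleton.bigP D ^ (1 + (|θ - 1| + 1))⌉₊
  · exact hwall hAss hb g hg N hN₁ hNδ
  · have hNδ' : ⌈Skeleton.bigP D ^ (1 + (|θ - 1| + 1))⌉₊ ≤ N := (not_le.mp hNδ).le
    have hℓ0 : 0 < Skeleton.ell D := zero_lt_one.trans (Skeleton.one_lt_ell hD3)
    have hP : 0 < Skeleton.bigP D := Real.exp_pos _
    have hlogPpos : 0 < Real.log (Skeleton.bigP D) := by
      rw [Skeleton.bigP, Real.log_exp]; exact pow_pos hℓ0 9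
    have hNδ1 : 1 ≤ ⌈Skeleton.bigP D ^ (1 + (|θ - 1| + 1))⌉₊ :=
      Nat.one_le_ceil_iff.mpr (Real.rpow_pos_of_pos hP _)
    have hpoly : ∀ (x : Skeleton.Chr D) (s : ℂ),
        profPoly χ x g N s = profPoly χ x g ⌈Skeleton.bigP D ^ (1 + (|θ - 1| + 1))⌉₊ s := by
      intro x s
      rw [profPoly_eq_add_coefBlock χ x g hNδ1 hNδ' s]
      have hzero : coefBlock χ x (profCoef D g) ⌈Skeleton.bigP D ^ (1 + (|θ - 1| + 1))⌉₊ N s = 0 := by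
        refine Finset.sum_eq_zero fun n hn => ?_
        have hn : ⌈Skeleton.bigP D ^ (1 + (|θ - 1| + 1))⌉₊ ≤ n := (Finset.mem_Ico.mp hn).1
        have hnr : Skeleton.bigP D ^ (1 + (|θ - 1| + 1)) ≤ (n : ℝ) :=
          (Nat.le_ceil _).trans (by exact_mod_cast hn)
        have hθn : θ ≤ Real.log n / Real.log (Skeleton.bigP D) := by
          rw [le_div_iff₀ hlogPpos]
          have h1 := Real.log_le_log (Real.rpow_pos_of_pos hP _) hnr
          rw [Real.log_rpow hP] at h1
          calc θ * Real.log (Skeleton.bigP D) ≤ (1 + (|θ - 1| + 1)) * Real.log (Skeleton.bigP D) :=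
                mul_le_mul_of_nonneg_right hθ hlogPpos.le
            _ ≤ Real.log n := h1
        simp only [profCoef]
        rw [hg0 _ hθn]; ring
      rw [hzero, add_zero]
    have hmean : discMean c' χ g N = discMean c' χ g ⌈Skeleton.bigP D ^ (1 + (|θ - 1| + 1))⌉₊ := by
      simp only [discMean, hpoly]
    rw [hmean]
    have hPle : ⌈Skeleton.bigP D⌉₊ ≤ ⌈Skeleton.bigP D ^ (1 + (|θ - 1| + 1))⌉₊ := by
      refine Nat.ceil_mono ?_
      have hP1 : 1 ≤ Skeleton.bigP D := by
        rw [Skeleton.bigP]; exact Real.one_le_exp (pow_nonneg hℓ0.le 9)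
      calc Skeleton.bigP D = Skeleton.bigP D ^ (1:ℝ) := (Real.rpow_one _).symm
        _ ≤ Skeleton.bigP D ^ (1 + (|θ - 1| + 1)) := Real.rpow_le_rpow_of_exponent_le hP1 (by linarith)
    exact hwall hAss hb g hg _ hPle le_rfl

/-! ### Part 6 (v2) — ROWS OF RECORD 41′–44′: the class-restricted slot E-004″ `BandMeanValueLip` displayed -/

/-- **Verdict (E-004″ form)** for a wall-value-zero design `(c′, g)`: as `VerdictBandMV` with the CLASS-RESTRICTED slot
`BandMeanValueLip c′ 1 1078 κ` (the band mean-square inequality for the coefficient sequences of `WallZeroLip 1` only).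
[cite: Zhang2022LandauSiegel, §2 (2.16)–(2.20), (2.30)–(2.31); §7 Prop 7.1; §8 Lemma 8.1] -/
def WallZeroDesign.VerdictBandMVLip (d : WallZeroDesign) : Prop :=
  ∀ ⦃δ : ℝ⦄, 0 < δ → ∀ ⦃η κ : ℝ⦄, 0 < η → κ < 6 → BandMeanValueLip d.c' 1 1078 κ →
    Prop71 d.c' → Lemma81 d.c' → Prop22i → Lemma23 d.c' →
      Skeleton.ForAllLarge fun D _ χ => Skeleton.AssumptionA D χ →
        (∀ i ∈ Skeleton.idx χ, (i.2).re = 1 / 2) →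
          ∀ N : ℕ, ⌈Skeleton.bigP D⌉₊ ≤ N → N ≤ ⌈Skeleton.bigP D ^ (1 + δ)⌉₊ →
            ¬ (η * (discMeanAbs d.c' χ d.g ⌈Skeleton.bigP D⌉₊ + Skeleton.frakA χ * frakP D) <
                |discMean d.c' χ d.g N - discMean d.c' χ d.g ⌈Skeleton.bigP D⌉₊|)

/-- **The slice theorem (E-004″ form).** [cite: Zhang2022LandauSiegel, §2 (2.16)–(2.20); §7 Prop 7.1; §8 Lemma 8.1] -/
theorem WallZeroDesign.verdictBandMVLip_of_inClass (d : WallZeroDesign) (h : d.InClass) : d.VerdictBandMVLip := by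
  intro δ hδ η κ hη hκ hB h71 h81 h22 h23
  refine (discMean_fromWall_of_bandMeanValueOn d.c' hδ 1 1 hκ hη (fun _ g hg => ⟨g, hg, rfl⟩) hB
    h71 h81 h22 h23).mono ?_
  intro D _ χ _ _ hflat hAss hb N hN₁ hN₂
  exact not_lt.2 (hflat hAss hb d.g (gluedWallZeroClass_of_wallZero d h) N hN₁ hN₂)

/-- family «wall value zero, from the wall to any bounded length; slot = E-004″ `BandMeanValueLip c′ 1 1078 κ` (κ < 6,
class-restricted) + the four mean-value nodes + (A) + (b); clean verdict» — ROW OF RECORD 41′.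
[cite: Zhang2022LandauSiegel, §2 (2.16)–(2.20), (2.30); §7 Prop 7.1; §8 Lemma 8.1] -/
def familyWallZeroBandMVLip : DesignFamily where
  Design := WallZeroDesign
  InClass := WallZeroDesign.InClass
  Verdict := WallZeroDesign.VerdictBandMVLip

/-- **`familyWallZeroBandMVLip` is decided.** [cite: Zhang2022LandauSiegel, §2 (2.16)–(2.20); §7 Prop 7.1; §8 Lemma 8.1] -/
theorem familyWallZeroBandMVLip_decided : familyWallZeroBandMVLip.Decided :=
  fun d h => WallZeroDesign.verdictBandMVLip_of_inClass d h

/-- **Verdict (E-004″ form, top-vanishing)**: every `N ≥ ⌈P⌉`. [cite: Zhang2022LandauSiegel, §2 (2.16)–(2.20), (2.30)–(2.31); §7 Prop 7.1; §8 Lemma 8.1] -/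
def WallZeroTopDesign.VerdictBandMVLip (d : WallZeroTopDesign) : Prop :=
  ∀ ⦃η κ : ℝ⦄, 0 < η → κ < 6 → BandMeanValueLip d.c' 1 1078 κ →
    Prop71 d.c' → Lemma81 d.c' → Prop22i → Lemma23 d.c' →
      Skeleton.ForAllLarge fun D _ χ => Skeleton.AssumptionA D χ →
        (∀ i ∈ Skeleton.idx χ, (i.2).re = 1 / 2) →
          ∀ N : ℕ, ⌈Skeleton.bigP D⌉₊ ≤ N →
            ¬ (η * (discMeanAbs d.c' χ d.g ⌈Skeleton.bigP D⌉₊ + Skeleton.frakA χ * frakP D) <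
                |discMean d.c' χ d.g N - discMean d.c' χ d.g ⌈Skeleton.bigP D⌉₊|)

/-- **The slice theorem (E-004″ form, top-vanishing).** [cite: Zhang2022LandauSiegel, §2 (2.16)–(2.20); §7 Prop 7.1; §8 Lemma 8.1] -/
theorem WallZeroTopDesign.verdictBandMVLip_of_inClass (d : WallZeroTopDesign) (h : d.InClass) :
    d.VerdictBandMVLip := by
  intro η κ hη hκ hB h71 h81 h22 h23
  refine (discMean_fromWall_topVanishing_of_bandMeanValueOn d.c' d.θ 1 1 hκ hη (fun _ g hg => ⟨g, hg, rfl⟩) hB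
    h71 h81 h22 h23).mono ?_
  intro D _ χ _ _ hflat hAss hb N hN₁
  exact not_lt.2 (hflat hAss hb d.g (gluedWallZeroClass_of_wallZero d.toWallZeroDesign h.1) h.2 N hN₁)

/-- family «wall value zero, top-vanishing, full polynomial vs bulk; slot = E-004″ + the four nodes; clean verdict» —
ROW OF RECORD 42′. [cite: Zhang2022LandauSiegel, §2 (2.16)–(2.20), (2.30); §7 Prop 7.1; §8 Lemma 8.1] -/
def familyWallZeroTopBandMVLip : DesignFamily where
  Design := WallZeroTopDesign
  InClass := WallZeroTopDesign.InClass
  Verdict := WallZeroTopDesign.VerdictBandMVLip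

/-- **`familyWallZeroTopBandMVLip` is decided.** [cite: Zhang2022LandauSiegel, §2 (2.16)–(2.20); §7 Prop 7.1; §8 Lemma 8.1] -/
theorem familyWallZeroTopBandMVLip_decided : familyWallZeroTopBandMVLip.Decided :=
  fun d h => WallZeroTopDesign.verdictBandMVLip_of_inClass d h

/-- **Verdict (E-004″ form, glued class, bounded lengths)** for a smooth design `(c′, K, M, g)` with `g(1) = 0`: slot
`BandMeanValueLip c′ K 1078 κ` with the design's own Lipschitz constant.
[cite: Zhang2022LandauSiegel, §2 (2.16)–(2.20), (2.30)–(2.31); §7 Prop 7.1; §8 Lemma 8.1] -/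
def SmoothDesign.VerdictBandMVLip (d : SmoothDesign) : Prop :=
  ∀ ⦃δ : ℝ⦄, 0 < δ → ∀ ⦃η κ : ℝ⦄, 0 < η → κ < 6 → BandMeanValueLip d.c' d.K 1078 κ →
    Prop71 d.c' → Lemma81 d.c' → Prop22i → Lemma23 d.c' →
      Skeleton.ForAllLarge fun D _ χ => Skeleton.AssumptionA D χ →
        (∀ i ∈ Skeleton.idx χ, (i.2).re = 1 / 2) →
          ∀ N : ℕ, ⌈Skeleton.bigP D⌉₊ ≤ N → N ≤ ⌈Skeleton.bigP D ^ (1 + δ)⌉₊ →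
            ¬ (η * (discMeanAbs d.c' χ d.g ⌈Skeleton.bigP D⌉₊ + Skeleton.frakA χ * frakP D) <
                |discMean d.c' χ d.g N - discMean d.c' χ d.g ⌈Skeleton.bigP D⌉₊|)

/-- The slice theorem (E-004″ form, glued class, bounded lengths). [cite: Zhang2022LandauSiegel, §2 (2.16)–(2.20); §7 Prop 7.1; §8 Lemma 8.1] -/
theorem SmoothDesign.verdictBandMVLip_of_inClassWall0 (d : SmoothDesign) (h : d.InClass) (h0 : d.g 1 = 0) :
    d.VerdictBandMVLip := by
  intro δ hδ η κ hη hκ hB h71 h81 h22 h23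
  refine (discMean_fromWall_of_bandMeanValueOn d.c' hδ d.K d.M hκ hη (fun _ g hg => ⟨g, hg, rfl⟩) hB
    h71 h81 h22 h23).mono ?_
  intro D _ χ _ _ hflat hAss hb N hN₁ hN₂
  exact not_lt.2 (hflat hAss hb d.g ⟨h.1, h.2, h0⟩ N hN₁ hN₂)

/-- family «smooth design (any bulk, `K`-Lipschitz `‖·‖ ≤ M` overhang), wall value zero, bounded lengths; slot = E-004″
`BandMeanValueLip c′ K 1078 κ` + the four nodes; clean verdict» — ROW OF RECORD 43′ (class = row 37's).
[cite: Zhang2022LandauSiegel, §2 (2.16)–(2.20), (2.30); §7 Prop 7.1; §8 Lemma 8.1] -/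
def familySmoothWallZeroBandMVLip : DesignFamily where
  Design := SmoothDesign
  InClass d := d.InClass ∧ d.g 1 = 0
  Verdict := SmoothDesign.VerdictBandMVLip

/-- Same class as rows 37 / 43 (`familySmoothWallZeroTrueBand`). [cite: Zhang2022LandauSiegel, §7 (7.2) p.44] -/
theorem familySmoothWallZeroBandMVLip_inClass_iff (d : SmoothDesign) :
    familySmoothWallZeroBandMVLip.InClass d ↔ familySmoothWallZeroTrueBand.InClass d := Iff.rfl

/-- **`familySmoothWallZeroBandMVLip` is decided.** [cite: Zhang2022LandauSiegel, §2 (2.16)–(2.20); §7 Prop 7.1; §8 Lemma 8.1] -/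
theorem familySmoothWallZeroBandMVLip_decided : familySmoothWallZeroBandMVLip.Decided :=
  fun d h => SmoothDesign.verdictBandMVLip_of_inClassWall0 d h.1 h.2

/-- **Verdict (E-004″ form, glued class, top-vanishing, full polynomial)**: every `N ≥ ⌈P⌉`.
[cite: Zhang2022LandauSiegel, §2 (2.16)–(2.20), (2.30)–(2.31); §7 Prop 7.1; §8 Lemma 8.1] -/
def SmoothTopDesign.VerdictBandMVLip (d : SmoothTopDesign) : Prop :=
  ∀ ⦃η κ : ℝ⦄, 0 < η → κ < 6 → BandMeanValueLip d.c' d.K 1078 κ →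
    Prop71 d.c' → Lemma81 d.c' → Prop22i → Lemma23 d.c' →
      Skeleton.ForAllLarge fun D _ χ => Skeleton.AssumptionA D χ →
        (∀ i ∈ Skeleton.idx χ, (i.2).re = 1 / 2) →
          ∀ N : ℕ, ⌈Skeleton.bigP D⌉₊ ≤ N →
            ¬ (η * (discMeanAbs d.c' χ d.g ⌈Skeleton.bigP D⌉₊ + Skeleton.frakA χ * frakP D) <
                |discMean d.c' χ d.g N - discMean d.c' χ d.g ⌈Skeleton.bigP D⌉₊|)

/-- The slice theorem (E-004″ form, glued class, top-vanishing). [cite: Zhang2022LandauSiegel, §2 (2.16)–(2.20); §7 Prop 7.1; §8 Lemma 8.1] -/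
theorem SmoothTopDesign.verdictBandMVLip_of_inClassWall0 (d : SmoothTopDesign) (h : d.InClass) (h0 : d.g 1 = 0) :
    d.VerdictBandMVLip := by
  intro η κ hη hκ hB h71 h81 h22 h23
  refine (discMean_fromWall_topVanishing_of_bandMeanValueOn d.c' d.θ d.K d.M hκ hη (fun _ g hg => ⟨g, hg, rfl⟩) hB
    h71 h81 h22 h23).mono ?_
  intro D _ χ _ _ hflat hAss hb N hN₁
  exact not_lt.2 (hflat hAss hb d.g ⟨h.1.1, h.1.2, h0⟩ h.2 N hN₁)

/-- family «smooth top-vanishing design (any bulk), wall value zero, full polynomial vs bulk; slot = E-004″ + the four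
nodes; clean verdict» — ROW OF RECORD 44′ (class = row 38's). [cite: Zhang2022LandauSiegel, §2 (2.16)–(2.20), (2.30); §7 Prop 7.1; §8 Lemma 8.1] -/
def familySmoothTopWallZeroBandMVLip : DesignFamily where
  Design := SmoothTopDesign
  InClass d := d.InClass ∧ d.g 1 = 0
  Verdict := SmoothTopDesign.VerdictBandMVLip

/-- Same class as rows 38 / 44 (`familySmoothTopWallZeroTrueBand`). [cite: Zhang2022LandauSiegel, §7 (7.2) p.44] -/
theorem familySmoothTopWallZeroBandMVLip_inClass_iff (d : SmoothTopDesign) :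
    familySmoothTopWallZeroBandMVLip.InClass d ↔ familySmoothTopWallZeroTrueBand.InClass d := Iff.rfl

/-- **`familySmoothTopWallZeroBandMVLip` is decided.** [cite: Zhang2022LandauSiegel, §2 (2.16)–(2.20); §7 Prop 7.1; §8 Lemma 8.1] -/
theorem familySmoothTopWallZeroBandMVLip_decided : familySmoothTopWallZeroBandMVLip.Decided :=
  fun d h => SmoothTopDesign.verdictBandMVLip_of_inClassWall0 d h.1 h.2

/-- C4 for the rows of record: the triangular overhang (rows 41′/42′), every p459259 wall-zero design with `K = M = 1`
(row 43′) and the glued class-text design `u ⊕ v` with ANY bulk (row 44′). [cite: Zhang2022LandauSiegel, §7 (7.2) p.44] -/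
theorem familyBandMVLip_members (c' : ℝ) {θ : ℝ} (hθ : 1 ≤ θ) (hθ3 : θ ≤ 3) (d : WallZeroDesign) (h : d.InClass)
    (u v : ℝ → ℂ) {K : ℝ≥0} {M : ℝ} (hv : LipschitzOnWith K v (Set.Icc 1 θ))
    (hM : ∀ z ∈ Set.Icc 1 θ, ‖v z‖ ≤ M) (hwall : v 1 = 0) (htop : v θ = 0) :
    familyWallZeroBandMVLip.InClass (WallZeroDesign.mk c' fun y => ((max 0 (min (y - 1) (θ - y)) : ℝ) : ℂ)) ∧
      familyWallZeroTopBandMVLip.InClass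
        (WallZeroTopDesign.mk ⟨c', fun y => ((max 0 (min (y - 1) (θ - y)) : ℝ) : ℂ)⟩ θ) ∧
      familySmoothWallZeroBandMVLip.InClass (SmoothDesign.mk d.c' 1 1 d.g) ∧
      familySmoothTopWallZeroBandMVLip.InClass
        (SmoothTopDesign.mk ⟨c', K, M, fun z => if z < 1 then u z else v (min z θ)⟩ θ) :=
  ⟨inClass_triangle c' hθ hθ3, inClassTop_triangle c' hθ hθ3, inClassWall0_ofWallZero d h,
    inClassWall0_glue c' hθ u v hv hM hwall htop⟩

/-- Rows 41–44 (all-coefficients slot) IMPLY rows 41′–44′'s premises are weaker: `BandMeanValue ⇒ BandMeanValueLip`, so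
every verdict of the primed rows follows from the corresponding unprimed hypothesis list as well (recorded for the
class-table bookkeeping; the primed rows are the rows of record). [cite: Zhang2022LandauSiegel, §2 (2.16)–(2.20)] -/
theorem verdictBandMVLip_of_bandMeanValue_hyp (d : WallZeroDesign) (h : d.InClass) {δ η κ : ℝ} (hδ : 0 < δ)
    (hη : 0 < η) (hκ : κ < 6) (hB : BandMeanValue d.c' 1078 κ) (h71 : Prop71 d.c') (h81 : Lemma81 d.c')
    (h22 : Prop22i) (h23 : Lemma23 d.c') :
    Skeleton.ForAllLarge fun D _ χ => Skeleton.AssumptionA D χ →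
      (∀ i ∈ Skeleton.idx χ, (i.2).re = 1 / 2) →
        ∀ N : ℕ, ⌈Skeleton.bigP D⌉₊ ≤ N → N ≤ ⌈Skeleton.bigP D ^ (1 + δ)⌉₊ →
          ¬ (η * (discMeanAbs d.c' χ d.g ⌈Skeleton.bigP D⌉₊ + Skeleton.frakA χ * frakP D) <
              |discMean d.c' χ d.g N - discMean d.c' χ d.g ⌈Skeleton.bigP D⌉₊|) :=
  WallZeroDesign.verdictBandMVLip_of_inClass d h hδ hη hκ (hB.lip 1) h71 h81 h22 h23

/-- **`R⁺⁺`-step of this file, v2 (rows of record)**: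
`ClassDecided (Rplus ++ [familyWallZeroBandMVLip, familyWallZeroTopBandMVLip, familySmoothWallZeroBandMVLip, familySmoothTopWallZeroBandMVLip])`.
[cite: Zhang2022LandauSiegel, §2 (2.32)–(2.33); §7 (7.2) p.44] -/
theorem rplus_bandMVLip_decided :
    ClassDecided (Rplus ++ [familyWallZeroBandMVLip, familyWallZeroTopBandMVLip, familySmoothWallZeroBandMVLip,
      familySmoothTopWallZeroBandMVLip]) :=
  classDecided_append.2
    ⟨rplus_decided, classDecided_cons familyWallZeroBandMVLip_decided
      (classDecided_cons familyWallZeroTopBandMVLip_decided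
        (classDecided_cons familySmoothWallZeroBandMVLip_decided
          (classDecided_cons familySmoothTopWallZeroBandMVLip_decided classDecided_nil)))⟩

end Repair

end Literature.NumberTheory.LFunctions.Zhang2022
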